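/- Free lead seat `ym-line-cbag-p1` (prover-ym-line-cbag-p1-g20-0; own crux `BoxFloorAllGroups` stmt-QuantumFields-22254 CLOSED) on the
planner-of-record's LINE 5, route `HankelDensitySplitting`, crux `HankelDensityFloor` (stmt-QuantumFields-26618), registered stub 3
`stub_hankelLogConvex` — I-bis: the reflection-positive cones of the torus applied to the composite axial observables.  Helper file (`--supports
stmt-QuantumFields-26618`).  RECORD-type material; the Yang–Mills mass gap is NOT proved by anything here. -/
import Summits.QuantumFields.YangMills.Theorems.HankelDensitySplittingHankelDensityFloorLogConvexTorus

/-!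
# `HankelLogConvex` (stub 3 of crux `HankelDensityFloor`, route `HankelDensitySplitting`) — I-bis: the four Hankel families on the torus

Continuing `…LogConvexTorus` (same conventions: axial plaquettes `P(c,q)`, `s(q)`, the reflection-paired torus correlator `F_M` characterised by
`hF`; no definition).  The three reflection-positive cones of the tree (`wilsonExpectation_reflectionPositive_holds` — links, even `M`, `β ≥ 0`;
`wilsonExpectation_siteReflectionPositive` — sites, even `M`; `wilsonExpectation_oddReflectionPositive` — odd `M ≥ 3`, `β ≥ 0`, used next to BOTH
of its fixed hyperplanes) and the abstract centred Cauchy–Schwarz `RPCauchySchwarz.covariance_rp_cauchySchwarz`, fed with the composite observables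
`E_0(a)` / `E_s(a)` and the Gram identities `gram_link` / `gram_site` / `gram_top`, give the two Hankel families `0 ≤ F_M(2a)`,
`F_M(a+b)² ≤ F_M(2a) F_M(2b)` and `0 ≤ F_M(2a+1)`, `F_M(a+b+1)² ≤ F_M(2a+1) F_M(2b+1)` on all large tori of either parity (`fam_link_even`,
`fam_site_even`, `fam_link_odd`, `fam_site_odd`), whence `0 ≤ F_M(n)` (`1 ≤ n`, `n + 4 ≤ M`) and `F_M(n+1)² ≤ F_M(n) F_M(n+2)` (`1 ≤ n`,
`n + 7 ≤ M`) (`torusF_nonneg`, `torusF_logConvex`).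

References: K. Osterwalder, E. Seiler, Ann. Phys. 110 (1978) 440, §2; E. Seiler, LNP 159 (1982) Ch. 2; J. Fröhlich, R. Israel, E. Lieb,
B. Simon, CMP 62 (1978) 1.  NOT the Yang–Mills mass gap; not the crux `HankelDensityFloor` either.
-/

noncomputable section

open MeasureTheory ProbabilityTheory Filter Topology
open scoped ComplexOrder
open Literature.MathematicalPhysics.QuantumFieldTheory
open Summit.QuantumFields.YangMills.Theorems.FiniteSusceptibilityWeakCoupling

namespace Summit.QuantumFields.YangMills.Theorems.HankelDensitySplitting

namespace LogConvex

variable {G : Type*} [Group G] [TopologicalSpace G] [IsTopologicalGroup G] [CompactSpace G]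
  [MeasurableSpace G] [BorelSpace G] {N : ℕ} (ρ : G →* Matrix (Fin N) (Fin N) ℂ)

section Torus

variable {M : ℕ} [NeZero M] {β : ℝ} {F : ZMod M → ℝ}
  (hF : ∀ n : ZMod M, F n = ∑ q : {p : Fin 4 × Fin 4 // p.1 < p.2}, ∑ q' : {p : Fin 4 × Fin 4 // p.1 < p.2},
    cov[fun U => WilsonRP.plaqRe ρ U ((Pi.single 0 0 : Site 4 M), q),
      fun U => WilsonRP.plaqRe ρ U ((Pi.single 0 (n - (if q.1.1 = 0 then (0 : ZMod M) else 1)) : Site 4 M), q');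
      wilsonMeasure (d := 4) (L := M) ρ β])
include hF

/-! ### The four Hankel families from the three reflection-positive cones -/

/-- **Link reflection, even torus, bottom family** (`β ≥ 0`): for `1 ≤ a, b` with `a + 1, b + 1 ≤ M/2`:
`0 ≤ F_M(2a)` and `F_M(a+b)² ≤ F_M(2a) F_M(2b)`. [folklore] -/
theorem fam_link_even (hM : Even M) (hρ : Continuous ρ) (hβ : 0 ≤ β) {a b : ℕ}
    (ha1 : 1 ≤ a) (ha : a + 1 ≤ M / 2) (hb1 : 1 ≤ b) (hb : b + 1 ≤ M / 2) :
    0 ≤ F ((2 * a : ℕ) : ZMod M) ∧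
      F ((a + b : ℕ) : ZMod M) ^ 2 ≤ F ((2 * a : ℕ) : ZMod M) * F ((2 * b : ℕ) : ZMod M) := by
  haveI : Fact (1 < M) := ⟨by obtain ⟨r, hr⟩ := hM; have := NeZero.ne M; omega⟩
  haveI := isProbabilityMeasure_wilsonMeasure (d := 4) (L := M) ρ hρ β
  -- the cone: observables of the positive links
  have hpos : ∀ {u : ℕ}, 1 ≤ u → u + 1 ≤ M / 2 → ∀ q : {p : Fin 4 × Fin 4 // p.1 < p.2},
      DependsOn (fun U : GaugeConfig 4 M G => WilsonRP.plaqRe ρ U ((Pi.single 0 (u : ZMod M) : Site 4 M), q))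
        {e : Edge 4 M | WilsonRP.IsPosEdge e} := by
    intro u hu1 hu q
    have huM : u < M := by omega
    have hp : WilsonRP.IsPosPlaq ((Pi.single 0 (u : ZMod M) : Site 4 M), q) := by
      show 1 ≤ ((Pi.single 0 (u : ZMod M) : Site 4 M) 0).val ∧
        (if q.1.1 = 0 then ((Pi.single 0 (u : ZMod M) : Site 4 M) 0).val + 1 ≤ M / 2
          else ((Pi.single 0 (u : ZMod M) : Site 4 M) 0).val ≤ M / 2)
      rw [AxialLogConvexity.val_axis_natCast huM]
      refine ⟨hu1, ?_⟩
      split_ifs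
      · exact hu
      · omega
    obtain ⟨h1, h2, h3, h4⟩ := WilsonRP.isPosEdge_of_isPosPlaq hp
    exact AxialLogConvexity.dependsOn_tplaq ρ _ h1 h2 h3 h4
  have hconeA : DependsOn (fun U : GaugeConfig 4 M G =>
      ∑ q : {p : Fin 4 × Fin 4 // p.1 < p.2}, WilsonRP.plaqRe ρ U ((Pi.single 0 ((fun _ => (a : ZMod M)) q) : Site 4 M), q))
      {e : Edge 4 M | WilsonRP.IsPosEdge e} := dependsOn_comp ρ _ fun q => hpos ha1 ha q
  have hconeB : DependsOn (fun U : GaugeConfig 4 M G =>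
      ∑ q : {p : Fin 4 × Fin 4 // p.1 < p.2}, WilsonRP.plaqRe ρ U ((Pi.single 0 ((fun _ => (b : ZMod M)) q) : Site 4 M), q))
      {e : Edge 4 M | WilsonRP.IsPosEdge e} := dependsOn_comp ρ _ fun q => hpos hb1 hb q
  have h := RPCauchySchwarz.covariance_rp_cauchySchwarz (μ := wilsonMeasure (d := 4) (L := M) ρ β)
    (Θ := GaugeConfig.timeReflect) WilsonRP.measurable_timeReflect
    (RPCauchySchwarz.wilsonMeasure_map_timeReflect ρ hρ β) RPCauchySchwarz.timeReflect_timeReflect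
    (D := fun H => DependsOn H {e : Edge 4 M | WilsonRP.IsPosEdge e})
    (fun H hH hHb hHD => AxialLogConvexity.integral_real_rp ρ β GaugeConfig.timeReflect H
      (wilsonExpectation_reflectionPositive_holds (d := 4) (L := M) ρ hM hρ hβ
        (fun U => ((H U : ℝ) : ℂ)) (Complex.measurable_ofReal.comp hH) (AxialLogConvexity.norm_ofReal_le_of_abs_le hHb)
        (fun U V hUV => by
          have hUV' : H U = H V := hHD fun e he => hUV e he.1 he.2.1 he.2.2.1 he.2.2.2
          simp only [hUV'])))
    (fun H K c hH hK => RPCauchySchwarz.dependsOn_add_mul hH hK c)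
    (fun H c hH => RPCauchySchwarz.dependsOn_sub_const hH c)
    (measurable_comp ρ hρ _) (measurable_comp ρ hρ _) (bounded_comp ρ hρ _) (bounded_comp ρ hρ _) hconeA hconeB
  simp only [gram_link ρ hF hρ] at h
  have e1 : ((2 * a : ℕ) : ZMod M) = (a : ZMod M) + (a : ZMod M) := by push_cast; ring
  have e2 : ((2 * b : ℕ) : ZMod M) = (b : ZMod M) + (b : ZMod M) := by push_cast; ring
  have e3 : ((a + b : ℕ) : ZMod M) = (a : ZMod M) + (b : ZMod M) := by push_cast; ring
  rw [e1, e2, e3]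
  exact ⟨h.1, h.2.2⟩

/-- **Site reflection, even torus** (any `β`): for `a + 1, b + 1 ≤ M/2`: `0 ≤ F_M(2a+1)` and `F_M(a+b+1)² ≤ F_M(2a+1) F_M(2b+1)`.
The spatial plaquettes of `E_0(0)` lie in the reflection hyperplane (shared links). [folklore] -/
theorem fam_site_even (hM : Even M) (hρ : Continuous ρ) {a b : ℕ} (ha : a + 1 ≤ M / 2) (hb : b + 1 ≤ M / 2) :
    0 ≤ F ((2 * a + 1 : ℕ) : ZMod M) ∧
      F ((a + b + 1 : ℕ) : ZMod M) ^ 2 ≤ F ((2 * a + 1 : ℕ) : ZMod M) * F ((2 * b + 1 : ℕ) : ZMod M) := by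
  haveI : Fact (1 < M) := ⟨by obtain ⟨r, hr⟩ := hM; have := NeZero.ne M; omega⟩
  haveI := isProbabilityMeasure_wilsonMeasure (d := 4) (L := M) ρ hρ β
  have hpos : ∀ {u : ℕ}, u + 1 ≤ M / 2 → ∀ q : {p : Fin 4 × Fin 4 // p.1 < p.2},
      DependsOn (fun U : GaugeConfig 4 M G => WilsonRP.plaqRe ρ U ((Pi.single 0 (u : ZMod M) : Site 4 M), q))
        ((WilsonSiteRP.sitePosEdges ∪ WilsonSiteRP.sharedEdges : Finset (Edge 4 M)) : Set (Edge 4 M)) := by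
    intro u hu q
    have huM : u < M := by omega
    by_cases hsh : q.1.1 ≠ 0 ∧ u = 0
    · -- a spatial plaquette in the hyperplane `t = 0`: shared links
      have hp : WilsonSiteRP.IsSharedPlaq ((Pi.single 0 (u : ZMod M) : Site 4 M), q) := by
        refine ⟨hsh.1, Or.inl ?_⟩
        show ((Pi.single 0 (u : ZMod M) : Site 4 M) 0).val = 0
        rw [AxialLogConvexity.val_axis_natCast huM, hsh.2]
      obtain ⟨h1, h2, h3, h4⟩ := WilsonSiteRP.edges_of_isSharedPlaq hp
      refine AxialLogConvexity.dependsOn_tplaq ρ _ ?_ ?_ ?_ ?_ <;>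
        simp only [Finset.coe_union, Set.mem_union, Finset.mem_coe, WilsonSiteRP.mem_sitePosEdges,
          WilsonSiteRP.mem_sharedEdges] <;> exact Or.inr ‹_›
    · have hp : WilsonSiteRP.IsSitePosPlaq ((Pi.single 0 (u : ZMod M) : Site 4 M), q) := by
        show if q.1.1 = 0 then ((Pi.single 0 (u : ZMod M) : Site 4 M) 0).val < M / 2
          else 1 ≤ ((Pi.single 0 (u : ZMod M) : Site 4 M) 0).val ∧
            ((Pi.single 0 (u : ZMod M) : Site 4 M) 0).val < M / 2
        rw [AxialLogConvexity.val_axis_natCast huM]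
        split_ifs with hq
        · omega
        · have : u ≠ 0 := fun h0 => hsh ⟨hq, h0⟩
          omega
      obtain ⟨h1, h2, h3, h4⟩ := WilsonSiteRP.edges_of_isSitePosPlaq hM hp
      refine AxialLogConvexity.dependsOn_tplaq ρ _ ?_ ?_ ?_ ?_ <;>
        simp only [Finset.coe_union, Set.mem_union, Finset.mem_coe, WilsonSiteRP.mem_sitePosEdges,
          WilsonSiteRP.mem_sharedEdges] <;> assumption
  have hconeA : DependsOn (fun U : GaugeConfig 4 M G =>
      ∑ q : {p : Fin 4 × Fin 4 // p.1 < p.2}, WilsonRP.plaqRe ρ U ((Pi.single 0 ((fun _ => (a : ZMod M)) q) : Site 4 M), q))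
      ((WilsonSiteRP.sitePosEdges ∪ WilsonSiteRP.sharedEdges : Finset (Edge 4 M)) : Set (Edge 4 M)) :=
    dependsOn_comp ρ _ fun q => hpos ha q
  have hconeB : DependsOn (fun U : GaugeConfig 4 M G =>
      ∑ q : {p : Fin 4 × Fin 4 // p.1 < p.2}, WilsonRP.plaqRe ρ U ((Pi.single 0 ((fun _ => (b : ZMod M)) q) : Site 4 M), q))
      ((WilsonSiteRP.sitePosEdges ∪ WilsonSiteRP.sharedEdges : Finset (Edge 4 M)) : Set (Edge 4 M)) :=
    dependsOn_comp ρ _ fun q => hpos hb q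
  have h := RPCauchySchwarz.covariance_rp_cauchySchwarz (μ := wilsonMeasure (d := 4) (L := M) ρ β)
    (Θ := GaugeConfig.negReflect) WilsonSiteRP.measurable_negReflect
    (WilsonSiteRP.wilsonMeasure_map_negReflect ρ hM hρ β) WilsonSiteRP.negReflect_negReflect_config
    (D := fun H => DependsOn H
      ((WilsonSiteRP.sitePosEdges ∪ WilsonSiteRP.sharedEdges : Finset (Edge 4 M)) : Set (Edge 4 M)))
    (fun H hH hHb hHD => AxialLogConvexity.integral_real_rp ρ β GaugeConfig.negReflect H
      (wilsonExpectation_siteReflectionPositive (d := 4) (L := M) ρ hM hρ β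
        (fun U => ((H U : ℝ) : ℂ)) (Complex.measurable_ofReal.comp hH) (AxialLogConvexity.norm_ofReal_le_of_abs_le hHb)
        (fun U V hUV => by
          have hUV' : H U = H V := hHD hUV
          simp only [hUV'])))
    (fun H K c hH hK => RPCauchySchwarz.dependsOn_add_mul hH hK c)
    (fun H c hH => RPCauchySchwarz.dependsOn_sub_const hH c)
    (measurable_comp ρ hρ _) (measurable_comp ρ hρ _) (bounded_comp ρ hρ _) (bounded_comp ρ hρ _) hconeA hconeB
  simp only [gram_site ρ hF hρ] at h
  have e1 : ((2 * a + 1 : ℕ) : ZMod M) = (a : ZMod M) + (a : ZMod M) + 1 := by push_cast; ring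
  have e2 : ((2 * b + 1 : ℕ) : ZMod M) = (b : ZMod M) + (b : ZMod M) + 1 := by push_cast; ring
  have e3 : ((a + b + 1 : ℕ) : ZMod M) = (a : ZMod M) + (b : ZMod M) + 1 := by push_cast; ring
  rw [e1, e2, e3]
  exact ⟨h.1, h.2.2⟩

/-- **Mixed reflection, odd torus, bottom family** (`M` odd, `M ≥ 3`, `β ≥ 0`): for `1 ≤ a, b ≤ M/2`:
`0 ≤ F_M(2a)` and `F_M(a+b)² ≤ F_M(2a) F_M(2b)` (plaquettes next to the link hyperplane). [folklore] -/
theorem fam_link_odd (hM : Odd M) (hM3 : 3 ≤ M) (hρ : Continuous ρ) (hβ : 0 ≤ β) {a b : ℕ}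
    (ha1 : 1 ≤ a) (ha : a ≤ M / 2) (hb1 : 1 ≤ b) (hb : b ≤ M / 2) :
    0 ≤ F ((2 * a : ℕ) : ZMod M) ∧
      F ((a + b : ℕ) : ZMod M) ^ 2 ≤ F ((2 * a : ℕ) : ZMod M) * F ((2 * b : ℕ) : ZMod M) := by
  haveI : Fact (1 < M) := ⟨by omega⟩
  haveI := isProbabilityMeasure_wilsonMeasure (d := 4) (L := M) ρ hρ β
  have hpos : ∀ {u : ℕ}, 1 ≤ u → u ≤ M / 2 → ∀ q : {p : Fin 4 × Fin 4 // p.1 < p.2},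
      DependsOn (fun U : GaugeConfig 4 M G => WilsonRP.plaqRe ρ U ((Pi.single 0 (u : ZMod M) : Site 4 M), q))
        ((WilsonOddRP.oPosEdges ∪ WilsonOddRP.oSharedEdges : Finset (Edge 4 M)) : Set (Edge 4 M)) := by
    intro u hu1 hu q
    have huM : u < M := by omega
    have hp : WilsonOddRP.IsOPosPlaq ((Pi.single 0 (u : ZMod M) : Site 4 M), q) := by
      show 1 ≤ ((Pi.single 0 (u : ZMod M) : Site 4 M) 0).val ∧
        ((Pi.single 0 (u : ZMod M) : Site 4 M) 0).val ≤ M / 2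
      rw [AxialLogConvexity.val_axis_natCast huM]
      exact ⟨hu1, hu⟩
    obtain ⟨h1, h2, h3, h4⟩ := WilsonOddRP.edges_of_isOPosPlaq hM hp
    refine AxialLogConvexity.dependsOn_tplaq ρ _ ?_ ?_ ?_ ?_ <;>
      simp only [Finset.coe_union, Set.mem_union, Finset.mem_coe, WilsonOddRP.mem_oPosEdges,
        WilsonOddRP.mem_oSharedEdges] <;> assumption
  have hconeA : DependsOn (fun U : GaugeConfig 4 M G =>
      ∑ q : {p : Fin 4 × Fin 4 // p.1 < p.2}, WilsonRP.plaqRe ρ U ((Pi.single 0 ((fun _ => (a : ZMod M)) q) : Site 4 M), q))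
      ((WilsonOddRP.oPosEdges ∪ WilsonOddRP.oSharedEdges : Finset (Edge 4 M)) : Set (Edge 4 M)) :=
    dependsOn_comp ρ _ fun q => hpos ha1 ha q
  have hconeB : DependsOn (fun U : GaugeConfig 4 M G =>
      ∑ q : {p : Fin 4 × Fin 4 // p.1 < p.2}, WilsonRP.plaqRe ρ U ((Pi.single 0 ((fun _ => (b : ZMod M)) q) : Site 4 M), q))
      ((WilsonOddRP.oPosEdges ∪ WilsonOddRP.oSharedEdges : Finset (Edge 4 M)) : Set (Edge 4 M)) :=
    dependsOn_comp ρ _ fun q => hpos hb1 hb q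
  have h := RPCauchySchwarz.covariance_rp_cauchySchwarz (μ := wilsonMeasure (d := 4) (L := M) ρ β)
    (Θ := GaugeConfig.timeReflect) WilsonRP.measurable_timeReflect
    (RPCauchySchwarz.wilsonMeasure_map_timeReflect ρ hρ β) RPCauchySchwarz.timeReflect_timeReflect
    (D := fun H => DependsOn H
      ((WilsonOddRP.oPosEdges ∪ WilsonOddRP.oSharedEdges : Finset (Edge 4 M)) : Set (Edge 4 M)))
    (fun H hH hHb hHD => AxialLogConvexity.integral_real_rp ρ β GaugeConfig.timeReflect H
      (wilsonExpectation_oddReflectionPositive (d := 4) (L := M) ρ hM hM3 hρ hβ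
        (fun U => ((H U : ℝ) : ℂ)) (Complex.measurable_ofReal.comp hH) (AxialLogConvexity.norm_ofReal_le_of_abs_le hHb)
        (fun U V hUV => by
          have hUV' : H U = H V := hHD hUV
          simp only [hUV'])))
    (fun H K c hH hK => RPCauchySchwarz.dependsOn_add_mul hH hK c)
    (fun H c hH => RPCauchySchwarz.dependsOn_sub_const hH c)
    (measurable_comp ρ hρ _) (measurable_comp ρ hρ _) (bounded_comp ρ hρ _) (bounded_comp ρ hρ _) hconeA hconeB
  simp only [gram_link ρ hF hρ] at h
  have e1 : ((2 * a : ℕ) : ZMod M) = (a : ZMod M) + (a : ZMod M) := by push_cast; ring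
  have e2 : ((2 * b : ℕ) : ZMod M) = (b : ZMod M) + (b : ZMod M) := by push_cast; ring
  have e3 : ((a + b : ℕ) : ZMod M) = (a : ZMod M) + (b : ZMod M) := by push_cast; ring
  rw [e1, e2, e3]
  exact ⟨h.1, h.2.2⟩

/-- **Mixed reflection, odd torus, top family** (`M = 2m+1 ≥ 3`, `β ≥ 0`): for `α + 1, β' + 1 ≤ m`:
`0 ≤ F_M(2α+1)` and `F_M(α+β'+1)² ≤ F_M(2α+1) F_M(2β'+1)` — the flipped densities `E_s(m − α)` next to the SITE hyperplane `t = m + 1`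
(their top spatial plaquettes lie in it: shared links), and `−((m−α) + (m−β')) ≡ α + β' + 1 (mod 2m+1)`. [folklore] -/
theorem fam_site_odd {m : ℕ} (hm : M = 2 * m + 1) (hM3 : 3 ≤ M) (hρ : Continuous ρ) (hβ : 0 ≤ β) {a b : ℕ}
    (ha : a + 1 ≤ m) (hb : b + 1 ≤ m) :
    0 ≤ F ((2 * a + 1 : ℕ) : ZMod M) ∧
      F ((a + b + 1 : ℕ) : ZMod M) ^ 2 ≤ F ((2 * a + 1 : ℕ) : ZMod M) * F ((2 * b + 1 : ℕ) : ZMod M) := by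
  haveI : Fact (1 < M) := ⟨by omega⟩
  haveI := isProbabilityMeasure_wilsonMeasure (d := 4) (L := M) ρ hρ β
  have hM : Odd M := ⟨m, hm⟩
  have hM2 : M / 2 = m := by omega
  -- the cone: `E_s(u)` for `1 ≤ u ≤ m` (temporal plaquettes at `u ≤ m`, spatial ones at `u + 1 ≤ m + 1`, shared at `m + 1`)
  have hpos : ∀ {u : ℕ}, 1 ≤ u → u ≤ m → ∀ q : {p : Fin 4 × Fin 4 // p.1 < p.2},
      DependsOn (fun U : GaugeConfig 4 M G => WilsonRP.plaqRe ρ U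
        ((Pi.single 0 ((u : ZMod M) + (if q.1.1 = 0 then (0 : ZMod M) else 1)) : Site 4 M), q))
        ((WilsonOddRP.oPosEdges ∪ WilsonOddRP.oSharedEdges : Finset (Edge 4 M)) : Set (Edge 4 M)) := by
    intro u hu1 hu q
    by_cases hq : q.1.1 = 0
    · simp only [hq, ↓reduceIte, add_zero]
      have huM : u < M := by omega
      have hp : WilsonOddRP.IsOPosPlaq ((Pi.single 0 (u : ZMod M) : Site 4 M), q) := by
        show 1 ≤ ((Pi.single 0 (u : ZMod M) : Site 4 M) 0).val ∧
          ((Pi.single 0 (u : ZMod M) : Site 4 M) 0).val ≤ M / 2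
        rw [AxialLogConvexity.val_axis_natCast huM]
        exact ⟨hu1, by omega⟩
      obtain ⟨h1, h2, h3, h4⟩ := WilsonOddRP.edges_of_isOPosPlaq hM hp
      refine AxialLogConvexity.dependsOn_tplaq ρ _ ?_ ?_ ?_ ?_ <;>
        simp only [Finset.coe_union, Set.mem_union, Finset.mem_coe, WilsonOddRP.mem_oPosEdges,
          WilsonOddRP.mem_oSharedEdges] <;> assumption
    · simp only [hq, ↓reduceIte]
      have hcast : (u : ZMod M) + 1 = ((u + 1 : ℕ) : ZMod M) := by push_cast; ring
      rw [hcast]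
      have huM : u + 1 < M := by omega
      by_cases htop : u = m
      · -- the spatial plaquette in the site hyperplane `t = m + 1`
        have hp : WilsonOddRP.IsOSharedPlaq ((Pi.single 0 ((u + 1 : ℕ) : ZMod M) : Site 4 M), q) := by
          refine ⟨hq, ?_⟩
          show ((Pi.single 0 ((u + 1 : ℕ) : ZMod M) : Site 4 M) 0).val = M / 2 + 1
          rw [AxialLogConvexity.val_axis_natCast huM, hM2, htop]
        obtain ⟨h1, h2, h3, h4⟩ := WilsonOddRP.edges_of_isOSharedPlaq hp
        refine AxialLogConvexity.dependsOn_tplaq ρ _ ?_ ?_ ?_ ?_ <;>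
          simp only [Finset.coe_union, Set.mem_union, Finset.mem_coe, WilsonOddRP.mem_oPosEdges,
            WilsonOddRP.mem_oSharedEdges] <;> exact Or.inr ‹_›
      · have hp : WilsonOddRP.IsOPosPlaq ((Pi.single 0 ((u + 1 : ℕ) : ZMod M) : Site 4 M), q) := by
          show 1 ≤ ((Pi.single 0 ((u + 1 : ℕ) : ZMod M) : Site 4 M) 0).val ∧
            ((Pi.single 0 ((u + 1 : ℕ) : ZMod M) : Site 4 M) 0).val ≤ M / 2
          rw [AxialLogConvexity.val_axis_natCast huM]
          exact ⟨by omega, by omega⟩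
        obtain ⟨h1, h2, h3, h4⟩ := WilsonOddRP.edges_of_isOPosPlaq hM hp
        refine AxialLogConvexity.dependsOn_tplaq ρ _ ?_ ?_ ?_ ?_ <;>
          simp only [Finset.coe_union, Set.mem_union, Finset.mem_coe, WilsonOddRP.mem_oPosEdges,
            WilsonOddRP.mem_oSharedEdges] <;> assumption
  have hconeA : DependsOn (fun U : GaugeConfig 4 M G =>
      ∑ q : {p : Fin 4 × Fin 4 // p.1 < p.2}, WilsonRP.plaqRe ρ U
        ((Pi.single 0 (((m - a : ℕ) : ZMod M) + (if q.1.1 = 0 then (0 : ZMod M) else 1)) : Site 4 M), q))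
      ((WilsonOddRP.oPosEdges ∪ WilsonOddRP.oSharedEdges : Finset (Edge 4 M)) : Set (Edge 4 M)) :=
    dependsOn_comp ρ (fun q => ((m - a : ℕ) : ZMod M) + (if q.1.1 = 0 then (0 : ZMod M) else 1))
      fun q => hpos (by omega) (by omega) q
  have hconeB : DependsOn (fun U : GaugeConfig 4 M G =>
      ∑ q : {p : Fin 4 × Fin 4 // p.1 < p.2}, WilsonRP.plaqRe ρ U
        ((Pi.single 0 (((m - b : ℕ) : ZMod M) + (if q.1.1 = 0 then (0 : ZMod M) else 1)) : Site 4 M), q))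
      ((WilsonOddRP.oPosEdges ∪ WilsonOddRP.oSharedEdges : Finset (Edge 4 M)) : Set (Edge 4 M)) :=
    dependsOn_comp ρ (fun q => ((m - b : ℕ) : ZMod M) + (if q.1.1 = 0 then (0 : ZMod M) else 1))
      fun q => hpos (by omega) (by omega) q
  have h := RPCauchySchwarz.covariance_rp_cauchySchwarz (μ := wilsonMeasure (d := 4) (L := M) ρ β)
    (Θ := GaugeConfig.timeReflect) WilsonRP.measurable_timeReflect
    (RPCauchySchwarz.wilsonMeasure_map_timeReflect ρ hρ β) RPCauchySchwarz.timeReflect_timeReflect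
    (D := fun H => DependsOn H
      ((WilsonOddRP.oPosEdges ∪ WilsonOddRP.oSharedEdges : Finset (Edge 4 M)) : Set (Edge 4 M)))
    (fun H hH hHb hHD => AxialLogConvexity.integral_real_rp ρ β GaugeConfig.timeReflect H
      (wilsonExpectation_oddReflectionPositive (d := 4) (L := M) ρ hM hM3 hρ hβ
        (fun U => ((H U : ℝ) : ℂ)) (Complex.measurable_ofReal.comp hH) (AxialLogConvexity.norm_ofReal_le_of_abs_le hHb)
        (fun U V hUV => by
          have hUV' : H U = H V := hHD hUV
          simp only [hUV'])))
    (fun H K c hH hK => RPCauchySchwarz.dependsOn_add_mul hH hK c)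
    (fun H c hH => RPCauchySchwarz.dependsOn_sub_const hH c)
    (measurable_comp ρ hρ _) (measurable_comp ρ hρ _) (bounded_comp ρ hρ _) (bounded_comp ρ hρ _) hconeA hconeB
  simp only [gram_top ρ hF hρ] at h
  have hMz : ((M : ℕ) : ZMod M) = 0 := ZMod.natCast_self M
  have e1 : ((2 * a + 1 : ℕ) : ZMod M) = -(((m - a : ℕ) : ZMod M) + ((m - a : ℕ) : ZMod M)) := by
    have : ((2 * a + 1 : ℕ) : ZMod M) + (((m - a : ℕ) : ZMod M) + ((m - a : ℕ) : ZMod M)) = 0 := by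
      rw [← hMz, hm]; push_cast [Nat.cast_sub (show a ≤ m by omega)]; ring
    exact eq_neg_of_add_eq_zero_left this
  have e2 : ((2 * b + 1 : ℕ) : ZMod M) = -(((m - b : ℕ) : ZMod M) + ((m - b : ℕ) : ZMod M)) := by
    have : ((2 * b + 1 : ℕ) : ZMod M) + (((m - b : ℕ) : ZMod M) + ((m - b : ℕ) : ZMod M)) = 0 := by
      rw [← hMz, hm]; push_cast [Nat.cast_sub (show b ≤ m by omega)]; ring
    exact eq_neg_of_add_eq_zero_left this
  have e3 : ((a + b + 1 : ℕ) : ZMod M) = -(((m - a : ℕ) : ZMod M) + ((m - b : ℕ) : ZMod M)) := by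
    have : ((a + b + 1 : ℕ) : ZMod M) + (((m - a : ℕ) : ZMod M) + ((m - b : ℕ) : ZMod M)) = 0 := by
      rw [← hMz, hm]; push_cast [Nat.cast_sub (show a ≤ m by omega), Nat.cast_sub (show b ≤ m by omega)]; ring
    exact eq_neg_of_add_eq_zero_left this
  rw [e1, e2, e3]
  exact ⟨h.1, h.2.2⟩

/-! ### All parities -/

/-- **Positivity of the torus reflection-paired correlator**: `0 ≤ F_M(n)` for `1 ≤ n`, `n + 4 ≤ M`, `β ≥ 0`. [folklore] -/
theorem torusF_nonneg (hρ : Continuous ρ) (hβ : 0 ≤ β) {n : ℕ} (hn1 : 1 ≤ n) (hn : n + 4 ≤ M) :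
    0 ≤ F ((n : ℕ) : ZMod M) := by
  rcases Nat.even_or_odd M with hM | hM
  · have hE := Nat.even_iff.mp hM
    rcases Nat.even_or_odd n with ⟨k, hk⟩ | ⟨k, hk⟩
    · have h := (fam_link_even ρ hF hM hρ hβ (a := k) (b := k) (by omega) (by omega) (by omega) (by omega)).1
      rwa [show 2 * k = n by omega] at h
    · have h := (fam_site_even ρ hF hM hρ (a := k) (b := k) (by omega) (by omega)).1
      rwa [show 2 * k + 1 = n by omega] at h
  · obtain ⟨m, hm⟩ := hM
    rcases Nat.even_or_odd n with ⟨k, hk⟩ | ⟨k, hk⟩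
    · have h := (fam_link_odd ρ hF ⟨m, hm⟩ (by omega) hρ hβ (a := k) (b := k) (by omega) (by omega)
        (by omega) (by omega)).1
      rwa [show 2 * k = n by omega] at h
    · have h := (fam_site_odd ρ hF hm (by omega) hρ hβ (a := k) (b := k) (by omega) (by omega)).1
      rwa [show 2 * k + 1 = n by omega] at h

/-- **Log-convexity of the torus reflection-paired correlator**: `F_M(n+1)² ≤ F_M(n) F_M(n+2)` for `1 ≤ n`, `n + 7 ≤ M`, `β ≥ 0`.
[folklore] -/
theorem torusF_logConvex (hρ : Continuous ρ) (hβ : 0 ≤ β) {n : ℕ} (hn1 : 1 ≤ n) (hn : n + 7 ≤ M) :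
    F ((n + 1 : ℕ) : ZMod M) ^ 2 ≤ F ((n : ℕ) : ZMod M) * F ((n + 2 : ℕ) : ZMod M) := by
  rcases Nat.even_or_odd M with hM | hM
  · have hE := Nat.even_iff.mp hM
    rcases Nat.even_or_odd n with ⟨k, hk⟩ | ⟨k, hk⟩
    · -- `n`, `n + 2` even: link family with `a = k`, `b = k + 1`
      have h := (fam_link_even ρ hF hM hρ hβ (a := k) (b := k + 1) (by omega) (by omega) (by omega) (by omega)).2
      rwa [show 2 * k = n by omega, show 2 * (k + 1) = n + 2 by omega, show k + (k + 1) = n + 1 by omega] at h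
    · -- `n`, `n + 2` odd: site family with `a = k`, `b = k + 1`
      have h := (fam_site_even ρ hF hM hρ (a := k) (b := k + 1) (by omega) (by omega)).2
      rwa [show 2 * k + 1 = n by omega, show 2 * (k + 1) + 1 = n + 2 by omega,
        show k + (k + 1) + 1 = n + 1 by omega] at h
  · obtain ⟨m, hm⟩ := hM
    rcases Nat.even_or_odd n with ⟨k, hk⟩ | ⟨k, hk⟩
    · have h := (fam_link_odd ρ hF ⟨m, hm⟩ (by omega) hρ hβ (a := k) (b := k + 1) (by omega) (by omega)
        (by omega) (by omega)).2
      rwa [show 2 * k = n by omega, show 2 * (k + 1) = n + 2 by omega, show k + (k + 1) = n + 1 by omega] at h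
    · have h := (fam_site_odd ρ hF hm (by omega) hρ hβ (a := k) (b := k + 1) (by omega) (by omega)).2
      rwa [show 2 * k + 1 = n by omega, show 2 * (k + 1) + 1 = n + 2 by omega,
        show k + (k + 1) + 1 = n + 1 by omega] at h

end Torus

end LogConvex

end Summit.QuantumFields.YangMills.Theorems.HankelDensitySplitting

end
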